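import Summits.AtomisticToContinuum.Crystallization.Theses.SurfaceTensionNoFoam

/-!
# Birth skeleton — crux `SurfaceTensionNoFoam.ExposedSitesCost`

Item `stmt-AtomisticToContinuum-13448` (crux, rank 2, route `SurfaceTensionNoFoam`, sub-problem
`Crystallization`). The crux (configuration form of the card's Σ4/Σ5): there is a void radius
`r₀ > 0` such that for every observation radius `R > 0` some `c > 0` satisfies, for every `N` and
every `N`-particle Lennard-Jones ground state `x` in `ℝ³`,
`c · #{i : some p with dist p xᵢ ≤ R has all particles at distance ≥ r₀} ≤ E(N) − N·e*`,
`e* = ⨅_Q e(Q)` the periodic infimum.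

First cut (three named stubs; it is the route's own FORESEEN SPLIT 1 typed out — "ExposedSitesCost ⇐
VoidWallDeficitAtScale → SheetSurplusControl → ExposedSitesCost, glue = the half-bond identity
2𝓔 = Σᵢ 𝓔ⁱ" — with the void radius fixed at `r₀ = 1` as in the route's item `VoidWallDeficit`
and the scale bookkeeping separated from the wall deficit):

* `stub_voidWallDeficit` — the route item `VoidWallDeficit` (stmt-AtomisticToContinuum-13450, rank-4
  crux) BY NAME: a uniform binding deficit `γ > 0` at every particle on the wall of an empty open
  unit ball of a ground state, `2e* + γ ≤ 𝓔ⁱ`. The SURFACE input.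
* `stub_exposedNearWall` — scale bookkeeping (pure geometry + the proved minimal distance): for
  every `R > 0` there is `K(R)` with `#{i exposed at scale R} ≤ K · #{wall particles}` in every ground
  state (slide the empty unit ball at the witness point `p` towards its nearest particle: that
  particle is a wall particle within `2R` of `xᵢ`; then count with the `δ`-separation
  `LennardJonesMinimalDistance_holds` and `card_le_of_separated_of_dist_le`). TRUE, provable now, M.
* `stub_sheetSurplusControl` — the BULK input and the open heart ("why it might fail" of the crux,
  verbatim: over-bound `Z ≥ 13` sheets could carry surplus against the deficit of exposed sites):
  there is `θ < 1` such that in every ground state the NET over-binding of the non-wall particles,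
  `Σ_{i ∉ W} (e* − 𝓔ⁱ/2)`, is at most `θ ·` the wall deficit `Σ_{i ∈ W} (𝓔ⁱ/2 − e*)`. Net, not
  gross: interior frustration may compensate interior over-binding; only a positive surplus DENSITY
  carried against the walls kills it (TetrahedralFrustration barrier, relocated exactly here).

Assembly `ExposedSitesCost_of` (real proof, no `sorry`): for a ground state `E(N) = 𝓔(x)`, so by
`two_mul_interactionEnergy` `E(N) − N e* = Σᵢ (𝓔ⁱ/2 − e*) = Σ_W + Σ_{Wᶜ} ≥ (1 − θ) Σ_W ≥
(1 − θ)(γ/2)·#W ≥ ((1 − θ)γ/(2K))·#{exposed at scale R}`; take `r₀ = 1`, `c = (1 − θ)γ/(2K(R))`.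
Concludes the route decl `SurfaceTensionNoFoam.ExposedSitesCost` BY NAME. Sorries: exactly the
three stubs.
-/

namespace Summit.AtomisticToContinuum.Crystallization.Cruxes.ExposedSitesCost.Birth

open scoped BigOperators Classical

/-- **Stub 1 — void-wall deficit (the route item `VoidWallDeficit`, stmt-AtomisticToContinuum-13450,
by name).** There is `γ > 0` such that in every Lennard-Jones ground state every particle `xᵢ` on
the wall of an empty open unit ball (`∃ p, dist p xᵢ ≤ 1 ∧ ∀ j, 1 ≤ dist p xⱼ`; every convex-hull
particle qualifies) has site energy `𝓔ⁱ ≥ 2·e* + γ`. Strictly weaker in kind than the crux is not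
claimed: it is the pointwise SURFACE half (rank-4 crux of the route, size L; why it might fail: needs
ground-state-specific local structure beyond the proved separation 0.684). -/
theorem stub_voidWallDeficit : Summit.AtomisticToContinuum.Crystallization.Theses.SurfaceTensionNoFoam.VoidWallDeficit := by
  sorry

/-- **Stub 2 — exposed particles at scale `R` are controlled by wall particles (scale bookkeeping).**
For every `R > 0` there is `K > 0` such that in every Lennard-Jones ground state the number of
particles within `R` of the centre of an empty open unit ball is at most `K` times the number of
wall particles (those within `1` of such a centre). TRUE and provable now (size M): if `p` witnesses
exposure of `i`, let `ρ = min_j dist p xⱼ ∈ [1, R]` be attained at `k`; the point `p'` on the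
segment from `x_k` to `p` at distance `1` from `x_k` has `dist p' xⱼ ≥ ρ − (ρ − 1) = 1` for all `j`,
so `k` is a wall particle with `dist xᵢ x_k ≤ 2R`; by the proved separation `δ = 1/3`
(`LennardJonesMinimalDistance_holds`) and `card_le_of_separated_of_dist_le` each wall particle
accounts for at most `(12R + 1)³` exposed ones. -/
theorem stub_exposedNearWall : ∀ R : ℝ, 0 < R → ∃ K : ℝ, 0 < K ∧ ∀ (N : ℕ) (x : Fin N → EuclideanSpace ℝ (Fin 3)), Literature.MathematicalPhysics.StatisticalMechanics.IsGroundState Literature.MathematicalPhysics.StatisticalMechanics.lennardJones x → (Nat.card {i : Fin N // ∃ p : EuclideanSpace ℝ (Fin 3), dist p (x i) ≤ R ∧ ∀ j : Fin N, 1 ≤ dist p (x j)} : ℝ) ≤ K * (Nat.card {i : Fin N // ∃ p : EuclideanSpace ℝ (Fin 3), dist p (x i) ≤ 1 ∧ ∀ j : Fin N, 1 ≤ dist p (x j)} : ℝ) := by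
  sorry

/-- **Stub 3 — sheet-surplus control (the bulk half; the open heart).** There is `θ < 1` such that
in every Lennard-Jones ground state the NET over-binding of the non-wall particles is at most `θ`
times the total deficit of the wall particles:
`Σ_{i ∉ W} (e* − 𝓔ⁱ/2) ≤ θ · Σ_{i ∈ W} (𝓔ⁱ/2 − e*)`, `W` = particles on the wall of an empty open
unit ball, `e* = ⨅_Q e(Q)`. Why plausibly true: by `e_∞ = e*` (CrysEnergyLimit, proved) no bulk
region over-binds on average, the sub-ball bound makes net surplus a boundary quantity at every
scale, and the one-centre over-binding slack (1–3 %) is an order of magnitude below the void-wall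
deficit (≈ 15 % of `2|e*|`); why it might fail: `Z ≥ 13` over-bound SHEETS organised between two
half-crystal charges carrying positive surplus density (TetrahedralFrustration). Stated with
`∃ θ < 1`, not a hand-picked constant. -/
theorem stub_sheetSurplusControl : ∃ θ : ℝ, θ < 1 ∧ ∀ (N : ℕ) (x : Fin N → EuclideanSpace ℝ (Fin 3)), Literature.MathematicalPhysics.StatisticalMechanics.IsGroundState Literature.MathematicalPhysics.StatisticalMechanics.lennardJones x → (∑ i ∈ Finset.univ.filter (fun i : Fin N => ¬ ∃ p : EuclideanSpace ℝ (Fin 3), dist p (x i) ≤ 1 ∧ ∀ j : Fin N, 1 ≤ dist p (x j)), ((⨅ Q : Literature.MathematicalPhysics.StatisticalMechanics.PeriodicConfiguration 3, Q.energyPerParticle Literature.MathematicalPhysics.StatisticalMechanics.lennardJones) - Literature.MathematicalPhysics.StatisticalMechanics.siteEnergy Literature.MathematicalPhysics.StatisticalMechanics.lennardJones x i / 2)) ≤ θ * ∑ i ∈ Finset.univ.filter (fun i : Fin N => ∃ p : EuclideanSpace ℝ (Fin 3), dist p (x i) ≤ 1 ∧ ∀ j : Fin N, 1 ≤ dist p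 (x j)), (Literature.MathematicalPhysics.StatisticalMechanics.siteEnergy Literature.MathematicalPhysics.StatisticalMechanics.lennardJones x i / 2 - (⨅ Q : Literature.MathematicalPhysics.StatisticalMechanics.PeriodicConfiguration 3, Q.energyPerParticle Literature.MathematicalPhysics.StatisticalMechanics.lennardJones)) := by
  sorry

/-- **Assembly**: stub 1 → stub 2 → stub 3 → the crux, with `r₀ = 1` and `c = (1 − θ)γ/(2K(R))`.
For a ground state `𝓔(x) = E(N)`, so the half-bond identity `2𝓔 = Σᵢ 𝓔ⁱ`
(`two_mul_interactionEnergy`) gives `E(N) − N e* = Σᵢ (𝓔ⁱ/2 − e*)`; split the sum into wall and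
non-wall particles (`Finset.sum_filter_add_sum_filter_not`): the wall part is `≥ (γ/2)·#W` by
stub 1, the non-wall part is `≥ −θ ·` the wall part by stub 3, so the total is
`≥ (1 − θ)(γ/2)·#W ≥ c·#{exposed at scale R}` by stub 2. Concludes the route decl
`SurfaceTensionNoFoam.ExposedSitesCost` by name; no `sorry`. -/
theorem ExposedSitesCost_of : Summit.AtomisticToContinuum.Crystallization.Theses.SurfaceTensionNoFoam.VoidWallDeficit → (∀ R : ℝ, 0 < R → ∃ K : ℝ, 0 < K ∧ ∀ (N : ℕ) (x : Fin N → EuclideanSpace ℝ (Fin 3)), Literature.MathematicalPhysics.StatisticalMechanics.IsGroundState Literature.MathematicalPhysics.StatisticalMechanics.lennardJones x → (Nat.card {i : Fin N // ∃ p : EuclideanSpace ℝ (Fin 3), dist p (x i) ≤ R ∧ ∀ j : Fin N, 1 ≤ dist p (x j)} : ℝ) ≤ K * (Nat.card {i : Fin N // ∃ p : EuclideanSpace ℝ (Fin 3), dist p (x i) ≤ 1 ∧ ∀ j : Fin N, 1 ≤ dist p (x j)} : ℝ)) → (∃ θ : ℝ, θ < 1 ∧ ∀ (N : ℕ) (x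 : Fin N → EuclideanSpace ℝ (Fin 3)), Literature.MathematicalPhysics.StatisticalMechanics.IsGroundState Literature.MathematicalPhysics.StatisticalMechanics.lennardJones x → (∑ i ∈ Finset.univ.filter (fun i : Fin N => ¬ ∃ p : EuclideanSpace ℝ (Fin 3), dist p (x i) ≤ 1 ∧ ∀ j : Fin N, 1 ≤ dist p (x j)), ((⨅ Q : Literature.MathematicalPhysics.StatisticalMechanics.PeriodicConfiguration 3, Q.energyPerParticle Literature.MathematicalPhysics.StatisticalMechanics.lennardJones) - Literature.MathematicalPhysics.StatisticalMechanics.siteEnergy Literature.MathematicalPhysics.StatisticalMechanics.lennardJones x i / 2)) ≤ θ * ∑ i ∈ Finset.univ.filter (fun i : Fin N => ∃ p : EuclideanSpace ℝ (Fin 3), dist p (x i) ≤ 1 ∧ ∀ j : Fin N, 1 ≤ dist p (x j)), (Literature.MathematicalPhysics.StatisticalMechanics.siteEnergy Literature.MathematicalPhysics.StatisticalMechanics.lennardJones x i / 2 - (⨅ Q : Literature.MathematicalPhysics.StatisticalMechanics.PeriodicConfiguration 3, Q.energyPerParticle Literature.MathematicalPhysics.StatisticalMechanics.lennardJones))) →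 Summit.AtomisticToContinuum.Crystallization.Theses.SurfaceTensionNoFoam.ExposedSitesCost := by
  intro hVW hPack hSheet
  obtain ⟨γ, hγ, hVW⟩ := hVW
  obtain ⟨θ, hθ, hSheet⟩ := hSheet
  have hθ' : 0 < 1 - θ := sub_pos.2 hθ
  refine ⟨1, one_pos, fun R hR => ?_⟩
  obtain ⟨K, hK, hPack⟩ := hPack R hR
  refine ⟨(1 - θ) * γ / 2 / K, by positivity, fun N x hx => ?_⟩
  -- abbreviations
  set e : ℝ := (⨅ Q : Literature.MathematicalPhysics.StatisticalMechanics.PeriodicConfiguration 3,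
    Q.energyPerParticle Literature.MathematicalPhysics.StatisticalMechanics.lennardJones) with he
  set W : Fin N → Prop := fun i : Fin N =>
    ∃ p : EuclideanSpace ℝ (Fin 3), dist p (x i) ≤ 1 ∧ ∀ j : Fin N, 1 ≤ dist p (x j) with hW
  set a : Fin N → ℝ := fun i =>
    Literature.MathematicalPhysics.StatisticalMechanics.siteEnergy
      Literature.MathematicalPhysics.StatisticalMechanics.lennardJones x i / 2 - e with ha
  -- the half-bond identity: `E(N) - N e = ∑ i, a i`
  have h2 : ∑ i, Literature.MathematicalPhysics.StatisticalMechanics.siteEnergy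
      Literature.MathematicalPhysics.StatisticalMechanics.lennardJones x i =
      2 * Literature.MathematicalPhysics.StatisticalMechanics.groundStateEnergy
        Literature.MathematicalPhysics.StatisticalMechanics.lennardJones 3 N := by
    rw [← hx.2]
    exact (Literature.MathematicalPhysics.StatisticalMechanics.two_mul_interactionEnergy _ x).symm
  have hE : Literature.MathematicalPhysics.StatisticalMechanics.groundStateEnergy
      Literature.MathematicalPhysics.StatisticalMechanics.lennardJones 3 N - (N : ℝ) * e = ∑ i, a i := by
    have hsum : ∑ i, a i = (∑ i, Literature.MathematicalPhysics.StatisticalMechanics.siteEnergy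
        Literature.MathematicalPhysics.StatisticalMechanics.lennardJones x i) / 2 - (N : ℝ) * e := by
      simp only [ha, Finset.sum_sub_distrib, Finset.sum_div, Finset.sum_const, Finset.card_univ,
        Fintype.card_fin, nsmul_eq_mul]
    rw [hsum, h2]
    ring
  -- split into wall and non-wall particles
  have hsplit : ∑ i, a i =
      (∑ i ∈ Finset.univ.filter (fun i => W i), a i) +
        ∑ i ∈ Finset.univ.filter (fun i => ¬ W i), a i :=
    (Finset.sum_filter_add_sum_filter_not _ _ _).symm
  -- wall part: each wall particle has `a i ≥ γ / 2` (stub 1)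
  have hwall : γ / 2 * ((Finset.univ.filter (fun i => W i)).card : ℝ) ≤
      ∑ i ∈ Finset.univ.filter (fun i => W i), a i := by
    have hle : ∀ i ∈ Finset.univ.filter (fun i => W i), γ / 2 ≤ a i := by
      intro i hi
      have hWi : W i := (Finset.mem_filter.1 hi).2
      have hdef := hVW N x hx i hWi
      simp only [ha]
      linarith
    calc γ / 2 * ((Finset.univ.filter (fun i => W i)).card : ℝ)
        = ∑ _i ∈ Finset.univ.filter (fun i => W i), γ / 2 := by
          rw [Finset.sum_const, nsmul_eq_mul, mul_comm]
      _ ≤ ∑ i ∈ Finset.univ.filter (fun i => W i), a i := Finset.sum_le_sum hle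
  -- non-wall part: net over-binding dominated by the wall deficit (stub 3)
  have hbulk : -(θ * ∑ i ∈ Finset.univ.filter (fun i => W i), a i) ≤
      ∑ i ∈ Finset.univ.filter (fun i => ¬ W i), a i := by
    have h3 := hSheet N x hx
    have hneg : ∑ i ∈ Finset.univ.filter (fun i => ¬ W i), (e -
        Literature.MathematicalPhysics.StatisticalMechanics.siteEnergy
          Literature.MathematicalPhysics.StatisticalMechanics.lennardJones x i / 2) =
        -∑ i ∈ Finset.univ.filter (fun i => ¬ W i), a i := by
      rw [← Finset.sum_neg_distrib]
      exact Finset.sum_congr rfl fun i _ => by simp only [ha]; ring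
    have h3' : -∑ i ∈ Finset.univ.filter (fun i => ¬ W i), a i ≤
        θ * ∑ i ∈ Finset.univ.filter (fun i => W i), a i := by
      rw [← hneg]
      exact h3
    linarith
  -- counting: `Nat.card` of the wall subtype is the card of the filter
  have hcardW : (Nat.card {i : Fin N // W i} : ℝ) = ((Finset.univ.filter (fun i => W i)).card : ℝ) := by
    rw [Nat.card_eq_fintype_card, Fintype.card_subtype]
  have hcount := hPack N x hx
  -- combine
  have hWsum : (1 - θ) * ∑ i ∈ Finset.univ.filter (fun i => W i), a i ≤ ∑ i, a i := by
    rw [hsplit]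
    nlinarith [hbulk]
  calc (1 - θ) * γ / 2 / K *
        (Nat.card {i : Fin N // ∃ p : EuclideanSpace ℝ (Fin 3), dist p (x i) ≤ R ∧
          ∀ j : Fin N, 1 ≤ dist p (x j)} : ℝ)
      ≤ (1 - θ) * γ / 2 / K * (K * (Nat.card {i : Fin N // W i} : ℝ)) :=
        mul_le_mul_of_nonneg_left hcount (by positivity)
    _ = (1 - θ) * (γ / 2 * ((Finset.univ.filter (fun i => W i)).card : ℝ)) := by
        rw [hcardW]
        field_simp
    _ ≤ (1 - θ) * ∑ i ∈ Finset.univ.filter (fun i => W i), a i :=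
        mul_le_mul_of_nonneg_left hwall hθ'.le
    _ ≤ ∑ i, a i := hWsum
    _ = Literature.MathematicalPhysics.StatisticalMechanics.groundStateEnergy
          Literature.MathematicalPhysics.StatisticalMechanics.lennardJones 3 N - (N : ℝ) * e := hE.symm

/-- The assembly instantiated with the three stubs: the crux, modulo exactly the three `sorry`s
(by-name, hypothesis-free target of `ledger skeleton check`). -/
theorem ExposedSitesCost_proof : Summit.AtomisticToContinuum.Crystallization.Theses.SurfaceTensionNoFoam.ExposedSitesCost :=
  ExposedSitesCost_of stub_voidWallDeficit stub_exposedNearWall stub_sheetSurplusControl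

end Summit.AtomisticToContinuum.Crystallization.Cruxes.ExposedSitesCost.Birth
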